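import Mathlib
import Summits.PneNP.PneNP.Theorems.PositionalGamesMpgHardNpLanguageDefs

/-!
# Route PositionalGames — support item `MpgHardNpLanguage` (stmt-PneNP-1300): the certificate check is first-order

Theorem file for the closed query `mpgQuery` of `…Defs.lean` (proof of
`Summit.PneNP.PneNP.Theses.PositionalGames.MpgHardNpLanguage`): it is uniformly first-order
FO-definable (`isDef_mpgQuery`), hence its class of structures-with-a-witness is `∃SO`-definable
(`isESODefinable_mpg`) — the input to Fagin's easy direction `eso_subset_NP_holds`. Everything is
assembled from the closure API of the tree's `ESODefinability.lean` (`JQuery.IsDef`: connectives,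
quantifier blocks, atoms): generic definability of atoms by arity (`isDef_in1/in2`,
`isDef_wit1/wit2/wit3`), the concrete atoms, the successor relation `EP`, the order-derived
`IsMinP/CoversP/IsMaxP`, the ripple-carry transcript `AddQ` over uniformly definable row
families (`isDef_addQ`), and `Q1`, `Q2`, `Q3`.
-/

namespace Summit.PneNP.PneNP.Theorems.MpgNP

set_option linter.dupNamespace false -- `Summit.PneNP.PneNP.…`: summit = sub-problem (D-0017)

open Literature.ModelTheory.FiniteModelTheory Literature.Computability.Cryptography

/-! ### Generic definability of atoms (by arity) -/

section GenericAtoms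

variable {ar wit : List ℕ} {β : Type}

/-- Unary input atom at a variable. [folklore] -/
theorem isDef_in1 (s : Fin ar.length) (hs : ar.get s = 1) (x : β) :
    JQuery.IsDef (fun _ (R : RelTables ar _) (_ : RelTables wit _) (v : β → _) =>
      R s (fun i => ![v x] (Fin.cast hs i)) = true) :=
  (JQuery.isDef_inRel s fun i => ![x] (Fin.cast hs i)).of_iff fun n R W v => by
    have h : (v ∘ fun i => ![x] (Fin.cast hs i)) = fun i => ![v x] (Fin.cast hs i) := by
      funext i
      show v (![x] (Fin.cast hs i)) = ![v x] (Fin.cast hs i)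
      generalize Fin.cast hs i = i'
      fin_cases i'; rfl
    rw [h]

/-- Binary input atom at two variables. [folklore] -/
theorem isDef_in2 (s : Fin ar.length) (hs : ar.get s = 2) (x y : β) :
    JQuery.IsDef (fun _ (R : RelTables ar _) (_ : RelTables wit _) (v : β → _) =>
      R s (fun i => ![v x, v y] (Fin.cast hs i)) = true) :=
  (JQuery.isDef_inRel s fun i => ![x, y] (Fin.cast hs i)).of_iff fun n R W v => by
    have h : (v ∘ fun i => ![x, y] (Fin.cast hs i)) = fun i => ![v x, v y] (Fin.cast hs i) := by
      funext i
      show v (![x, y] (Fin.cast hs i)) = ![v x, v y] (Fin.cast hs i)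
      generalize Fin.cast hs i = i'
      fin_cases i' <;> rfl
    rw [h]

/-- Unary witness atom at a variable. [folklore] -/
theorem isDef_wit1 (s : Fin wit.length) (hs : wit.get s = 1) (x : β) :
    JQuery.IsDef (fun _ (_ : RelTables ar _) (W : RelTables wit _) (v : β → _) =>
      W s (fun i => ![v x] (Fin.cast hs i)) = true) :=
  (JQuery.isDef_witRel s fun i => ![x] (Fin.cast hs i)).of_iff fun n R W v => by
    have h : (v ∘ fun i => ![x] (Fin.cast hs i)) = fun i => ![v x] (Fin.cast hs i) := by
      funext i
      show v (![x] (Fin.cast hs i)) = ![v x] (Fin.cast hs i)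
      generalize Fin.cast hs i = i'
      fin_cases i'; rfl
    rw [h]

/-- Binary witness atom at two variables. [folklore] -/
theorem isDef_wit2 (s : Fin wit.length) (hs : wit.get s = 2) (x y : β) :
    JQuery.IsDef (fun _ (_ : RelTables ar _) (W : RelTables wit _) (v : β → _) =>
      W s (fun i => ![v x, v y] (Fin.cast hs i)) = true) :=
  (JQuery.isDef_witRel s fun i => ![x, y] (Fin.cast hs i)).of_iff fun n R W v => by
    have h : (v ∘ fun i => ![x, y] (Fin.cast hs i)) = fun i => ![v x, v y] (Fin.cast hs i) := by
      funext i
      show v (![x, y] (Fin.cast hs i)) = ![v x, v y] (Fin.cast hs i)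
      generalize Fin.cast hs i = i'
      fin_cases i' <;> rfl
    rw [h]

/-- Ternary witness atom at three variables. [folklore] -/
theorem isDef_wit3 (s : Fin wit.length) (hs : wit.get s = 3) (x y z : β) :
    JQuery.IsDef (fun _ (_ : RelTables ar _) (W : RelTables wit _) (v : β → _) =>
      W s (fun i => ![v x, v y, v z] (Fin.cast hs i)) = true) :=
  (JQuery.isDef_witRel s fun i => ![x, y, z] (Fin.cast hs i)).of_iff fun n R W v => by
    have h : (v ∘ fun i => ![x, y, z] (Fin.cast hs i)) = fun i => ![v x, v y, v z] (Fin.cast hs i) := by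
      funext i
      show v (![x, y, z] (Fin.cast hs i)) = ![v x, v y, v z] (Fin.cast hs i)
      generalize Fin.cast hs i = i'
      fin_cases i' <;> rfl
    rw [h]

end GenericAtoms

/-! ### Definability of the concrete atoms -/

section AtomDefs

variable {β : Type}

/-- `isV` is definable. [folklore] -/
theorem isDef_isV (x : β) : JQuery.IsDef (fun _ (R : RelTables inVocab _) (_ : RelTables witVocab _)
    (v : β → _) => isV R (v x)) := (isDef_in1 iIsV rfl x).of_iff fun _ _ _ _ => Iff.rfl
/-- `ow` is definable. [folklore] -/
theorem isDef_ow (x : β) : JQuery.IsDef (fun _ (R : RelTables inVocab _) (_ : RelTables witVocab _)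
    (v : β → _) => ow R (v x)) := (isDef_in1 iOw rfl x).of_iff fun _ _ _ _ => Iff.rfl
/-- `st` is definable. [folklore] -/
theorem isDef_st (x : β) : JQuery.IsDef (fun _ (R : RelTables inVocab _) (_ : RelTables witVocab _)
    (v : β → _) => st R (v x)) := (isDef_in1 iSt rfl x).of_iff fun _ _ _ _ => Iff.rfl
/-- `ed` is definable. [folklore] -/
theorem isDef_ed (x y : β) : JQuery.IsDef (fun _ (R : RelTables inVocab _) (_ : RelTables witVocab _)
    (v : β → _) => ed R (v x) (v y)) := (isDef_in2 iEd rfl x y).of_iff fun _ _ _ _ => Iff.rfl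
/-- `w2` is definable. [folklore] -/
theorem isDef_w2 (x y : β) : JQuery.IsDef (fun _ (R : RelTables inVocab _) (_ : RelTables witVocab _)
    (v : β → _) => w2 R (v x) (v y)) := (isDef_in2 iW2 rfl x y).of_iff fun _ _ _ _ => Iff.rfl
/-- `pn` is definable. [folklore] -/
theorem isDef_pn (x : β) : JQuery.IsDef (fun _ (R : RelTables inVocab _) (_ : RelTables witVocab _)
    (v : β → _) => pn R (v x)) := (isDef_in1 iPN rfl x).of_iff fun _ _ _ _ => Iff.rfl
/-- `lt` is definable. [folklore] -/
theorem isDef_ltA (x y : β) : JQuery.IsDef (fun _ (R : RelTables inVocab _) (_ : RelTables witVocab _)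
    (v : β → _) => lt R (v x) (v y)) := (isDef_in2 iLT rfl x y).of_iff fun _ _ _ _ => Iff.rfl
/-- `sg` is definable. [folklore] -/
theorem isDef_sg (x y : β) : JQuery.IsDef (fun _ (_ : RelTables inVocab _) (W : RelTables witVocab _)
    (v : β → _) => sg W (v x) (v y)) := (isDef_wit2 jSg rfl x y).of_iff fun _ _ _ _ => Iff.rfl
/-- `rr` is definable. [folklore] -/
theorem isDef_rr (x : β) : JQuery.IsDef (fun _ (_ : RelTables inVocab _) (W : RelTables witVocab _)
    (v : β → _) => rr W (v x)) := (isDef_wit1 jRr rfl x).of_iff fun _ _ _ _ => Iff.rfl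
/-- `ph` is definable. [folklore] -/
theorem isDef_ph (x y : β) : JQuery.IsDef (fun _ (_ : RelTables inVocab _) (W : RelTables witVocab _)
    (v : β → _) => ph W (v x) (v y)) := (isDef_wit2 jPh rfl x y).of_iff fun _ _ _ _ => Iff.rfl
/-- `s1` is definable. [folklore] -/
theorem isDef_s1 (x y : β) : JQuery.IsDef (fun _ (_ : RelTables inVocab _) (W : RelTables witVocab _)
    (v : β → _) => s1 W (v x) (v y)) := (isDef_wit2 jS1 rfl x y).of_iff fun _ _ _ _ => Iff.rfl
/-- `c1` is definable. [folklore] -/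
theorem isDef_c1 (x y : β) : JQuery.IsDef (fun _ (_ : RelTables inVocab _) (W : RelTables witVocab _)
    (v : β → _) => c1 W (v x) (v y)) := (isDef_wit2 jC1 rfl x y).of_iff fun _ _ _ _ => Iff.rfl
/-- `s2` is definable. [folklore] -/
theorem isDef_s2 (x y : β) : JQuery.IsDef (fun _ (_ : RelTables inVocab _) (W : RelTables witVocab _)
    (v : β → _) => s2 W (v x) (v y)) := (isDef_wit2 jS2 rfl x y).of_iff fun _ _ _ _ => Iff.rfl
/-- `c2` is definable. [folklore] -/
theorem isDef_c2 (x y : β) : JQuery.IsDef (fun _ (_ : RelTables inVocab _) (W : RelTables witVocab _)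
    (v : β → _) => c2 W (v x) (v y)) := (isDef_wit2 jC2 rfl x y).of_iff fun _ _ _ _ => Iff.rfl
/-- `dd` is definable. [folklore] -/
theorem isDef_dd (x y z : β) : JQuery.IsDef (fun _ (_ : RelTables inVocab _) (W : RelTables witVocab _)
    (v : β → _) => dd W (v x) (v y) (v z)) := (isDef_wit3 jDd rfl x y z).of_iff fun _ _ _ _ => Iff.rfl
/-- `c3` is definable. [folklore] -/
theorem isDef_c3 (x y z : β) : JQuery.IsDef (fun _ (_ : RelTables inVocab _) (W : RelTables witVocab _)
    (v : β → _) => c3 W (v x) (v y) (v z)) := (isDef_wit3 jC3 rfl x y z).of_iff fun _ _ _ _ => Iff.rfl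

end AtomDefs

/-! ### Definability of the query -/

section Definability

variable {β : Type}

/-- `EP` is definable. [folklore] -/
theorem isDef_EP (x y : β) : JQuery.IsDef (fun _ (R : RelTables inVocab _) (W : RelTables witVocab _)
    (v : β → _) => EP R W (v x) (v y)) :=
  ((isDef_isV x).and ((isDef_isV y).and ((((isDef_ow x).and ((isDef_sg x y).and (isDef_ed x y))).or
    ((isDef_ow x).not.and (isDef_ed x y).not))))).of_iff fun _ _ _ _ => Iff.rfl

/-- `IsMinP` is definable. [folklore] -/
theorem isDef_isMinP (y : β) : JQuery.IsDef (fun _ (R : RelTables inVocab _) (_ : RelTables witVocab _)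
    (v : β → _) => IsMinP R (v y)) :=
  ((isDef_ltA (β := β ⊕ Unit) (Sum.inr ()) (Sum.inl y)).not.all).of_iff fun _ _ _ _ => Iff.rfl

/-- `CoversP` is definable. [folklore] -/
theorem isDef_coversP (x y : β) : JQuery.IsDef (fun _ (R : RelTables inVocab _) (_ : RelTables witVocab _)
    (v : β → _) => CoversP R (v x) (v y)) :=
  ((isDef_ltA x y).and (((isDef_ltA (β := β ⊕ Unit) (Sum.inl x) (Sum.inr ())).and
    (isDef_ltA (Sum.inr ()) (Sum.inl y))).not.all)).of_iff fun _ _ _ _ => Iff.rfl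

/-- `IsMaxP` is definable. [folklore] -/
theorem isDef_isMaxP (y : β) : JQuery.IsDef (fun _ (R : RelTables inVocab _) (_ : RelTables witVocab _)
    (v : β → _) => IsMaxP R (v y)) :=
  ((isDef_ltA (β := β ⊕ Unit) (Sum.inl y) (Sum.inr ())).not.all).of_iff fun _ _ _ _ => Iff.rfl

/-- `MajP` of definable queries is definable. [folklore] -/
theorem isDef_majP {P Q S : JQuery inVocab witVocab β} (hP : P.IsDef) (hQ : Q.IsDef) (hS : S.IsDef) :
    JQuery.IsDef (fun _ R W (v : β → _) => MajP (P R W v) (Q R W v) (S R W v)) :=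
  ((hP.and hQ).or (hS.and (hP.iff hQ).not)).of_iff fun _ _ _ _ => Iff.rfl

/-- **`AddQ` of uniformly definable rows is definable.** [cite: Vollmer1999, §1.1] -/
theorem isDef_addQ {A B S C : ∀ ⦃n : ℕ⦄, RelTables inVocab n → RelTables witVocab n → (β → Fin n) →
    Fin n → Prop} (hA : RowDef A) (hB : RowDef B) (hS : RowDef S) (hC : RowDef C) :
    JQuery.IsDef (fun n (R : RelTables inVocab n) (W : RelTables witVocab n) (v : β → Fin n) =>
      AddQ R (A R W v) (B R W v) (S R W v) (C R W v)) := by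
  -- clause 1: carry-in
  have h1 : JQuery.IsDef (fun n (R : RelTables inVocab n) (W : RelTables witVocab n) (v : β → Fin n) =>
      ∀ j, IsMinP R j → ¬ C R W v j) :=
    ((isDef_isMinP (β := β ⊕ Unit) (Sum.inr ())).imp
      (hC _ Sum.inl (Sum.inr ())).not).all.of_iff fun _ _ _ _ => Iff.rfl
  -- clause 2: sum bits
  have h2 : JQuery.IsDef (fun n (R : RelTables inVocab n) (W : RelTables witVocab n) (v : β → Fin n) =>
      ∀ j, (S R W v j ↔ ((A R W v j ↔ B R W v j) ↔ C R W v j))) :=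
    ((hS _ Sum.inl (Sum.inr ())).iff (((hA (β ⊕ Unit) Sum.inl (Sum.inr ())).iff
      (hB _ Sum.inl (Sum.inr ()))).iff (hC _ Sum.inl (Sum.inr ())))).all.of_iff fun _ _ _ _ => Iff.rfl
  -- clause 3: carry propagation
  have h3 : JQuery.IsDef (fun n (R : RelTables inVocab n) (W : RelTables witVocab n) (v : β → Fin n) =>
      ∀ j j', CoversP R j j' → (C R W v j' ↔ MajP (A R W v j) (B R W v j) (C R W v j))) := by
    refine ((isDef_coversP (β := β ⊕ Fin 2) (Sum.inr 0) (Sum.inr 1)).imp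
      ((hC _ Sum.inl (Sum.inr 1)).iff (isDef_majP (hA (β ⊕ Fin 2) Sum.inl (Sum.inr 0))
        (hB _ Sum.inl (Sum.inr 0)) (hC _ Sum.inl (Sum.inr 0))))).alls.of_iff fun n R W v => ?_
    exact ⟨fun h j j' => by simpa using h ![j, j'], fun h w => h (w 0) (w 1)⟩
  -- clause 4: no overflow
  have h4 : JQuery.IsDef (fun n (R : RelTables inVocab n) (W : RelTables witVocab n) (v : β → Fin n) =>
      ∀ j, IsMaxP R j → ¬ MajP (A R W v j) (B R W v j) (C R W v j)) :=
    ((isDef_isMaxP (β := β ⊕ Unit) (Sum.inr ())).imp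
      (isDef_majP (hA (β ⊕ Unit) Sum.inl (Sum.inr ())) (hB _ Sum.inl (Sum.inr ()))
        (hC _ Sum.inl (Sum.inr ()))).not).all.of_iff fun _ _ _ _ => Iff.rfl
  exact ((h1.and h2).and (h3.and h4)).of_iff fun _ _ _ _ => by simp only [AddQ, and_assoc]

/-- `Q1` is definable. [folklore] -/
theorem isDef_Q1 : JQuery.IsDef (fun _ (R : RelTables inVocab _) (W : RelTables witVocab _)
    (_ : Empty → _) => Q1 R W) :=
  ((isDef_isV (β := Empty ⊕ Unit) (Sum.inr ())).imp ((isDef_ow (Sum.inr ())).imp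
    (isDef_EP (β := (Empty ⊕ Unit) ⊕ Unit) (Sum.inl (Sum.inr ())) (Sum.inr ())).ex)).all.of_iff
      fun _ _ _ _ => Iff.rfl

/-- `Q2` is definable. [folklore] -/
theorem isDef_Q2 : JQuery.IsDef (fun _ (R : RelTables inVocab _) (W : RelTables witVocab _)
    (_ : Empty → _) => Q2 R W) :=
  ((isDef_isV (β := Empty ⊕ Unit) (Sum.inr ())).and ((isDef_ow (Sum.inr ())).not.and
    (isDef_EP (β := (Empty ⊕ Unit) ⊕ Unit) (Sum.inl (Sum.inr ())) (Sum.inr ())).not.all)).ex.of_iff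
      fun _ _ _ _ => Iff.rfl

/-- `Q3` is definable. [folklore] -/
theorem isDef_Q3 : JQuery.IsDef (fun _ (R : RelTables inVocab _) (W : RelTables witVocab _)
    (_ : Empty → _) => Q3 R W) := by
  -- start in the set
  have h1 : JQuery.IsDef (fun _ (R : RelTables inVocab _) (W : RelTables witVocab _) (_ : Empty → _) =>
      ∀ a, st R a → rr W a) :=
    ((isDef_st (β := Empty ⊕ Unit) (Sum.inr ())).imp (isDef_rr (Sum.inr ()))).all.of_iff
      fun _ _ _ _ => Iff.rfl
  -- `S1 = Ph + PN`
  have h2 : JQuery.IsDef (fun _ (R : RelTables inVocab _) (W : RelTables witVocab _) (_ : Empty → _) =>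
      ∀ a, AddQ R (ph W a) (pn R) (s1 W a) (c1 W a)) :=
    (isDef_addQ (β := Empty ⊕ Unit)
      (A := fun _ _ W v j => ph W (v (Sum.inr ())) j) (B := fun _ R _ _ j => pn R j)
      (S := fun _ _ W v j => s1 W (v (Sum.inr ())) j) (C := fun _ _ W v j => c1 W (v (Sum.inr ())) j)
      (fun γ g y => isDef_ph (g (Sum.inr ())) y) (fun γ g y => isDef_pn y)
      (fun γ g y => isDef_s1 (g (Sum.inr ())) y) (fun γ g y => isDef_c1 (g (Sum.inr ())) y)).all.of_iff
      fun _ _ _ _ => Iff.rfl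
  -- `S2 = Ph + W2`
  have h3 : JQuery.IsDef (fun _ (R : RelTables inVocab _) (W : RelTables witVocab _) (_ : Empty → _) =>
      ∀ a, AddQ R (ph W a) (w2 R a) (s2 W a) (c2 W a)) :=
    (isDef_addQ (β := Empty ⊕ Unit)
      (A := fun _ _ W v j => ph W (v (Sum.inr ())) j) (B := fun _ R _ v j => w2 R (v (Sum.inr ())) j)
      (S := fun _ _ W v j => s2 W (v (Sum.inr ())) j) (C := fun _ _ W v j => c2 W (v (Sum.inr ())) j)
      (fun γ g y => isDef_ph (g (Sum.inr ())) y) (fun γ g y => isDef_w2 (g (Sum.inr ())) y)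
      (fun γ g y => isDef_s2 (g (Sum.inr ())) y) (fun γ g y => isDef_c2 (g (Sum.inr ())) y)).all.of_iff
      fun _ _ _ _ => Iff.rfl
  -- edges leaving the set
  have h4 : JQuery.IsDef (fun _ (R : RelTables inVocab _) (W : RelTables witVocab _) (_ : Empty → _) =>
      ∀ a b, rr W a → EP R W a b → rr W b ∧ AddQ R (s1 W b) (dd W a b) (s2 W a) (c3 W a b)) := by
    refine (((isDef_rr (β := Empty ⊕ Fin 2) (Sum.inr 0)).imp ((isDef_EP (Sum.inr 0) (Sum.inr 1)).imp
      ((isDef_rr (Sum.inr 1)).and (isDef_addQ (β := Empty ⊕ Fin 2)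
        (A := fun _ _ W v j => s1 W (v (Sum.inr 1)) j) (B := fun _ _ W v j => dd W (v (Sum.inr 0)) (v (Sum.inr 1)) j)
        (S := fun _ _ W v j => s2 W (v (Sum.inr 0)) j) (C := fun _ _ W v j => c3 W (v (Sum.inr 0)) (v (Sum.inr 1)) j)
        (fun γ g y => isDef_s1 (g (Sum.inr 1)) y) (fun γ g y => isDef_dd (g (Sum.inr 0)) (g (Sum.inr 1)) y)
        (fun γ g y => isDef_s2 (g (Sum.inr 0)) y)
        (fun γ g y => isDef_c3 (g (Sum.inr 0)) (g (Sum.inr 1)) y))))).alls).of_iff fun n R W v => ?_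
    exact ⟨fun h a b => by simpa using h ![a, b], fun h w => h (w 0) (w 1)⟩
  exact ((h1.and h2).and (h3.and h4)).of_iff fun _ _ _ _ => by simp only [Q3, and_assoc]

/-- **The certificate check is first-order** (`mpgQuery.IsDef`). [folklore] -/
theorem isDef_mpgQuery : mpgQuery.IsDef :=
  (isDef_Q1.and (isDef_Q2.or isDef_Q3)).of_iff fun _ _ _ _ => Iff.rfl

/-- Hence the class of structures with SOME witness tables passing the check is `∃SO`-definable.
[cite: Fagin1974, §2] -/
theorem isESODefinable_mpg : IsESODefinable inVocab (classOf mpgQuery) :=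
  IsESODefinable.of_isDef isDef_mpgQuery

/-- The closed check may be used under any variable context (its value does not depend on the
valuation) — the form in which `mpgQ` enters larger first-order constructions. [folklore] -/
theorem isDef_mpgQ_ofClosed (β : Type) :
    JQuery.IsDef (fun n (R : RelTables inVocab n) (W : RelTables witVocab n) (_ : β → Fin n) => mpgQ R W) :=
  isDef_mpgQuery.ofClosed

end Definability

end Summit.PneNP.PneNP.Theorems.MpgNP
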